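import Summits.BirchSwinnertonDyer.Rank1Residual.X11b.AnticyclotomicSelmer
import Literature.NumberTheory.EllipticCurves.IwasawaSelmerDualProofs
import Literature.NumberTheory.EllipticCurves.IwasawaAlgebra
import Literature.NumberTheory.EllipticCurves.AdditiveReductionSemistableModelProofs
import HarnessLib

/-!
# X11b, route R1 — the `Λ`-dual `X_ac^Σ(E[p^∞])` of Castella's anticyclotomic Selmer group,
# CONSTRUCTED as a `ℤ_p⟦T⟧`-module, and its characteristic ideal

HONEST FRAMING (cell `b2b-bsdres`, run/shared/lean/b2b/bsd-rank1-residual/, verbatim in every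
file): the goal of the cell is to DELETE the COMBINATION-SHAPED residual classes of the
Birch–Swinnerton-Dyer formula for ALL analytic-rank `≤ 1` elliptic curves over `ℚ` — "full BSD
formula for every rank `≤ 1` curve in class `C`" assembled STRICTLY from published theorems — so
that the rank-`≤ 1` remainder becomes exactly the CONSTRUCTION-SHAPED classes, which are TYPED
(missing-input `Prop`s), NOT attempted. This is not "finishing BSD". Sub-cell
`b2b-bsdres-multr1-p1` (X11b, route R1 = Castella 2018 Thm. A re-proved along the author's
erratum); a RESEARCH ROUTE; no claim beyond the stated class; X11b stays CONSTRUCTION-SHAPED;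
nothing here changes a label; no named fact is minted (definitions with bodies, instances and
proved theorems, plus ONE `Prop`-valued predicate with parameters naming a shape; no `sorry`).

## Content (sequel of `AnticyclotomicSelmer.lean`, which defines `selmerAc W p κ 𝔭 S =
Sel_𝔭^Σ(K_∞, E[p^∞])`, Cas18 Def. 2.2 in the `K_∞`-formulation)

Castella, Camb. J. Math. 6 (2018) §2.1 (arXiv:1704.06608 p. 5): "Set
`X_ac^Σ(E[p^∞]) := Hom_{ℤ_p}(Sel_𝔭^Σ(K_∞, E[p^∞]), ℚ_p/ℤ_p)`, which is easily shown to be a finitely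
generated `Λ`-module"; §2.2: "Letting `γ ∈ Γ` be a fixed topological generator, we identify the
one-variable power series ring `ℤ_p[[T]]` with the Iwasawa algebra `Λ = ℤ_p[[Γ]]` by sending
`1 + T ↦ γ`"; Thm. 2.3: "… `X_ac^Σ(E[p^∞])` is `Λ`-torsion, and letting `f_ac^Σ(T) ∈ Λ` be a generator
of `Ch_Λ(X_ac^Σ(E[p^∞]))`, we have `#ℤ_p/f_ac^Σ(0) = …`".

* `conjSelmerAc W p κ 𝔭 S γ`: `conj_γ` as an endomorphism of `Sel_𝔭^Σ(K_∞, E[p^∞])`;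
  **`isLocNil_conjSelmerAc_sub_one`**: for a topological generator `γ`, `conj_γ − 1` is locally
  nilpotent on the `p`-primary group `Sel_𝔭^Σ` (verbatim the argument of
  `WeierstrassCurve.isLocNil_conjSelmerInfty_sub_one` for the classical Selmer group: compactness of
  `Gal(K̄/K_∞)`, continuity of the `Γ`-action, `(γ − 1)^{kp^a}` kills a `p^k`-torsion class fixed by
  `γ^{p^a}`).
* **`XAc W p κ 𝔭 S γ = X_ac^Σ(E[p^∞]) := Hom(Sel_𝔭^Σ(K_∞, E[p^∞]), ℚ/ℤ)`** (`ℚ/ℤ = AddCircle (1 : ℚ)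
  ⊇ ℚ_p/ℤ_p` receives every character of the torsion group `Sel`, as in
  `WeierstrassCurve.SelmerDualData`), a type depending on `γ` (`[Fact (κ.IsTopGenerator γ)]`), with
  its `Λ = ℤ_p⟦T⟧ = IwasawaAlgebra p`-MODULE STRUCTURE `instModuleXAc` = `IwasawaDual.IsLocNil.module`
  — CONSTRUCTED, not assumed; `XAc.X_smul_apply` (`(T·x)(s) = x(conj_γ s) − x(s)`) and
  `XAc.C_smul_apply` (constants through `ℤ_p → ℤ/p^k`) certify the action is Castella's `1 + T ↦ γ`.
* **`XAc.charIdeal = Ch_Λ(X_ac^Σ(E[p^∞]))`** (the tree's `Module.charIdeal`).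
* `valuation_constantCoeff_eq_of_span_singleton_eq`: if `(f) = (g)` in `Λ` and `f(0) ≠ 0` then
  `g(0) ≠ 0` and `ord_p g(0) = ord_p f(0)` — "`#ℤ_p/f_ac^Σ(0)`" does not depend on the generator.
* `XAc.HasCharValuationAt … n` — the SHAPE "`X_ac^Σ` is `Λ`-torsion, `Ch_Λ(X_ac^Σ) = (f)` with
  `f(0) ≠ 0` and `ord_p f(0) = n`" ON THE REAL MODULE (the left-hand side of Cas18 Thm. 2.3 and of
  §5 (5.1)); `XAc.HasCharValuationAt.unique`: `n` is well defined. A predicate; nothing asserted.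

Intended use (route R1): `K` imaginary quadratic, `κ` the anticyclotomic `ℤ_p`-extension
(`ZpExtension.IsAnticyclotomic`), `p = 𝔭𝔭̄` split, `W` the base change of `E/ℚ`, `S = ∅`; then
`XAc.HasCharValuationAt … n` is the algebraic side "`ord_p f_ac(0) = n`" of the shadow
`LambdaAdicShadow.charValOrd` of `CastellaErratumLinks.lean`, now on a constructed object. Nothing is
asserted about finite generation, cotorsion, control or the main conjecture.

References: [Castella2018] §2.1 Def. 2.2, §2.2, Thm. 2.3 (arXiv:1704.06608 p. 5), §5 (5.1) (p. 12);
[Castella2018Erratum] Thm. 1.1; [GreenbergLNM1716] §1; [Lang1990] Ch. 5 §1; [Mazur1972] §6.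
-/

noncomputable section

open scoped Classical

open NumberField IsDedekindDomain Field
open Literature.NumberTheory.EllipticCurves Literature.NumberTheory.EllipticCurves.GreenbergSelmer
open Literature.NumberTheory.GaloisRepresentations

universe u

namespace Summit.BirchSwinnertonDyer.Rank1Residual.X11b.AcSelmer

variable {K : Type u} [Field K] [NumberField K]

/-! ## The `Γ`-action on `Sel_𝔭^Σ(K_∞, E[p^∞])` and local nilpotence of `γ − 1` -/

section Curve

variable (W : WeierstrassCurve K) (p : ℕ) [Fact p.Prime]
  (κ : ZpExtension K p) (𝔭 : HeightOneSpectrum (𝓞 K)) (S : Set (HeightOneSpectrum (𝓞 K)))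

/-- `conj_γ` restricted to an endomorphism of `Sel_𝔭^Σ(K_∞, E[p^∞])`. [cite: Castella2018, §2.1 (arXiv:1704.06608 p. 5)] -/
def conjSelmerAc (γ : absoluteGaloisGroup K) : AddMonoid.End (selmerAc W p κ 𝔭 S) :=
  ((W.conjH1 p κ.kerSubgroup γ).restrict (selmerAc W p κ 𝔭 S)).codRestrict (selmerAc W p κ 𝔭 S)
    fun s ↦ conjH1_mem_selmerAc γ s.2

/-- Unfolding `conjSelmerAc` (definitional). [folklore] -/
@[simp]
theorem coe_conjSelmerAc_apply (γ : absoluteGaloisGroup K) (s : selmerAc W p κ 𝔭 S) :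
    ((conjSelmerAc W p κ 𝔭 S γ s : selmerAc W p κ 𝔭 S) : W.subgroupH1 p κ.kerSubgroup) =
      W.conjH1 p κ.kerSubgroup γ s :=
  rfl

/-- Powers of the restriction are restrictions of `conj_{γ^m}`. [folklore] -/
theorem coe_conjSelmerAc_pow_apply (γ : absoluteGaloisGroup K) (m : ℕ) (s : selmerAc W p κ 𝔭 S) :
    ((((conjSelmerAc W p κ 𝔭 S γ) ^ m) s : selmerAc W p κ 𝔭 S) : W.subgroupH1 p κ.kerSubgroup) =
      W.conjH1 p κ.kerSubgroup (γ ^ m) s := by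
  induction m generalizing s with
  | zero => rw [pow_zero, pow_zero, AddMonoid.End.one_apply, W.conjH1_one_holds p κ.kerSubgroup,
      AddMonoidHom.id_apply]
  | succ m ih =>
    rw [pow_succ, AddMonoid.End.coe_mul, Function.comp_apply, ih, coe_conjSelmerAc_apply,
      pow_succ, W.conjH1_mul_holds p κ.kerSubgroup, AddMonoidHom.comp_apply]

/-- **`Sel_𝔭^Σ(K_∞, E[p^∞])` is `p`-primary and `T = γ − 1` is locally nilpotent on it** for `γ` a
topological generator of `Gal(K_∞/K)`: every class is killed by some `p^k` (compactness of
`Gal(K̄/K_∞)`, `WeierstrassCurve.exists_pow_smul_subgroupH1_ker_eq_zero`) and fixed by some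
`conj_{γ^{p^a}}` (continuity, `WeierstrassCurve.exists_conjH1_pow_prime_pow_eq`), hence killed by
`(conj_γ − 1)^{k p^a}` (`IwasawaDual.pow_mul_prime_pow_apply_eq_zero`). Verbatim the argument of
`WeierstrassCurve.isLocNil_conjSelmerInfty_sub_one` for the classical Selmer group.
[cite: GreenbergLNM1716, §1 (after Conj. 1.3)] -/
theorem isLocNil_conjSelmerAc_sub_one {γ : absoluteGaloisGroup K} (hγ : κ.IsTopGenerator γ) :
    IwasawaDual.IsLocNil p (conjSelmerAc W p κ 𝔭 S γ - 1) := by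
  have htor : ∀ s : selmerAc W p κ 𝔭 S, ∃ k : ℕ, p ^ k • s = 0 := fun s ↦ by
    obtain ⟨k, hk⟩ := W.exists_pow_smul_subgroupH1_ker_eq_zero κ (s : W.subgroupH1 p κ.kerSubgroup)
    exact ⟨k, Subtype.ext (by rw [AddSubgroupClass.coe_nsmul]; exact hk)⟩
  refine ⟨htor, fun s ↦ ?_⟩
  obtain ⟨a, ha⟩ := W.exists_conjH1_pow_prime_pow_eq κ hγ (s : W.subgroupH1 p κ.kerSubgroup)
  obtain ⟨k, hk⟩ := htor s
  have hφ : ((conjSelmerAc W p κ 𝔭 S γ) ^ p ^ a) s = s :=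
    Subtype.ext (by rw [coe_conjSelmerAc_pow_apply]; exact ha)
  exact ⟨k * p ^ a, IwasawaDual.pow_mul_prime_pow_apply_eq_zero (Fact.out : p.Prime) _ a hφ hk⟩

/-- **`X_ac^Σ(E[p^∞]) := Hom(Sel_𝔭^Σ(K_∞, E[p^∞]), ℚ/ℤ)`**, the Pontryagin dual of Castella's Selmer
group ("`X_ac^Σ(E[p^∞]) := Hom_{ℤ_p}(Sel_𝔭^Σ(K_∞,E[p^∞]), ℚ_p/ℤ_p)`"; `ℚ/ℤ = AddCircle (1 : ℚ)`
receives every character of the torsion group `Sel`, as in `WeierstrassCurve.SelmerDualData`), as a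
type depending on a topological generator `γ` of `Gal(K_∞/K)` (instance argument
`[Fact (κ.IsTopGenerator γ)]`) through which it is a `Λ = ℤ_p⟦T⟧`-module, `1 + T ↦ γ`
(`instModuleXAc`). [cite: Castella2018, Def. 2.2 (arXiv:1704.06608 p. 5)] -/
def XAc (γ : absoluteGaloisGroup K) [Fact (κ.IsTopGenerator γ)] : Type u :=
  selmerAc W p κ 𝔭 S →+ AddCircle (1 : ℚ)

variable (γ : absoluteGaloisGroup K) [hγ : Fact (κ.IsTopGenerator γ)]

/-- `X_ac^Σ` is an abelian group (pointwise). [folklore] -/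
instance instAddCommGroupXAc : AddCommGroup (XAc W p κ 𝔭 S γ) :=
  inferInstanceAs (AddCommGroup (selmerAc W p κ 𝔭 S →+ AddCircle (1 : ℚ)))

/-- Elements of `X_ac^Σ` are functions on `Sel_𝔭^Σ` (characters). [folklore] -/
instance instFunLikeXAc : FunLike (XAc W p κ 𝔭 S γ) (selmerAc W p κ 𝔭 S) (AddCircle (1 : ℚ)) :=
  inferInstanceAs (FunLike (selmerAc W p κ 𝔭 S →+ AddCircle (1 : ℚ)) _ _)

/-- Elements of `X_ac^Σ` are additive characters of `Sel_𝔭^Σ`. [folklore] -/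
instance instAddMonoidHomClassXAc :
    AddMonoidHomClass (XAc W p κ 𝔭 S γ) (selmerAc W p κ 𝔭 S) (AddCircle (1 : ℚ)) :=
  inferInstanceAs (AddMonoidHomClass (selmerAc W p κ 𝔭 S →+ AddCircle (1 : ℚ)) _ _)

/-- **The `Λ = ℤ_p⟦T⟧`-module structure of `X_ac^Σ(E[p^∞])`**, `T` acting as `conj_γ − 1` and the
constants through `ℤ_p → ℤ/p^k` (`IwasawaDual.IsLocNil.module` for
`isLocNil_conjSelmerAc_sub_one`): "we identify … `ℤ_p[[T]]` with the Iwasawa algebra `Λ = ℤ_p[[Γ]]`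
by sending `1 + T ↦ γ`" (Cas18 §2.2). CONSTRUCTED, not assumed.
[cite: Castella2018, §2.2 (arXiv:1704.06608 p. 5)] [cite: GreenbergLNM1716, §1 (after Conj. 1.3)] -/
instance instModuleXAc : Module (IwasawaAlgebra p) (XAc W p κ 𝔭 S γ) :=
  (isLocNil_conjSelmerAc_sub_one W p κ 𝔭 S hγ.out).module

namespace XAc

/-- **`T` acts as `γ − 1`** on `X_ac^Σ`: `(T·x)(s) = x(conj_γ s) − x(s)`.
[cite: Castella2018, §2.2 (arXiv:1704.06608 p. 5), "`1 + T ↦ γ`"] -/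
theorem X_smul_apply (x : XAc W p κ 𝔭 S γ) (s : selmerAc W p κ 𝔭 S) :
    ((PowerSeries.X : IwasawaAlgebra p) • x) s = x (conjSelmerAc W p κ 𝔭 S γ s) - x s := by
  show (isLocNil_conjSelmerAc_sub_one W p κ 𝔭 S hγ.out).smulFun PowerSeries.X x s = _
  rw [(isLocNil_conjSelmerAc_sub_one W p κ 𝔭 S hγ.out).smulFun_X_apply, IwasawaDual.End_sub_apply,
    AddMonoid.End.one_apply, map_sub]
  rfl

/-- **Constants `c ∈ ℤ_p` act through `ℤ_p → ℤ/p^k`** on the value at a `p^k`-torsion class: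
`(c·x)(s) = (c mod p^k) · x(s)`. [cite: Lang1990, Ch. 5 §1] -/
theorem C_smul_apply (c : ℤ_[p]) (x : XAc W p κ 𝔭 S γ) {s : selmerAc W p κ 𝔭 S} {k : ℕ}
    (hk : p ^ k • s = 0) :
    ((PowerSeries.C c : IwasawaAlgebra p) • x) s = (PadicInt.toZModPow k c).val • x s := by
  show (isLocNil_conjSelmerAc_sub_one W p κ 𝔭 S hγ.out).smulFun (PowerSeries.C c) x s = _
  exact (isLocNil_conjSelmerAc_sub_one W p κ 𝔭 S hγ.out).smulFun_C_apply c x hk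

/-- **`Ch_Λ(X_ac^Σ(E[p^∞])) ⊆ Λ`**, the characteristic ideal of the `Λ`-module `X_ac^Σ` (the tree's
`Module.charIdeal`: product over height-one primes of `𝔮^{length(X_𝔮)}`; meaningful for finitely
generated torsion `X`, which is NOT asserted here — Cas18 Thm. 2.3 / erratum Thm. 1.1 assert it under
hypotheses, see the companion file). A generator is Castella's `f_ac^Σ(T)`.
[cite: Castella2018, Thm. 2.3 (arXiv:1704.06608 p. 5), "a generator of `Ch_Λ(X_ac^Σ(E[p^∞]))`"] -/
def charIdeal : Ideal (IwasawaAlgebra p) :=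
  Literature.NumberTheory.EllipticCurves.Module.charIdeal (IwasawaAlgebra p) (XAc W p κ 𝔭 S γ)

end XAc

end Curve

/-! ## "`ord_p f(0)`" for a generator `f` of a principal ideal of `Λ` is well defined -/

section Valuation

variable {p : ℕ} [Fact p.Prime]

/-- **Generator independence of `ord_p f(0)`.** If `(f) = (g)` in `Λ = ℤ_p⟦T⟧` and `f(0) ≠ 0`, then
`g(0) ≠ 0` and `ord_p g(0) = ord_p f(0)`: `g = f·u` for a unit `u` of `Λ` (a domain), and `u(0)` is a
unit of `ℤ_p`. This is why "`#ℤ_p/f_ac^Σ(0)`" in Cas18 Thm. 2.3 does not depend on the chosen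
generator. [cite: Castella2018, Thm. 2.3 (arXiv:1704.06608 p. 5)] -/
theorem valuation_constantCoeff_eq_of_span_singleton_eq {f g : IwasawaAlgebra p}
    (h : Ideal.span ({f} : Set (IwasawaAlgebra p)) = Ideal.span {g})
    (hf : PowerSeries.constantCoeff f ≠ 0) :
    PowerSeries.constantCoeff g ≠ 0 ∧
      (PowerSeries.constantCoeff g).valuation = (PowerSeries.constantCoeff f).valuation := by
  obtain ⟨u, rfl⟩ := Ideal.span_singleton_eq_span_singleton.mp h
  have hu : IsUnit (PowerSeries.constantCoeff (u : IwasawaAlgebra p)) :=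
    PowerSeries.isUnit_constantCoeff _ u.isUnit
  have hu0 : PowerSeries.constantCoeff (u : IwasawaAlgebra p) ≠ 0 := hu.ne_zero
  rw [map_mul]
  refine ⟨mul_ne_zero hf hu0, ?_⟩
  rw [PadicInt.valuation_mul hf hu0, padicInt_valuation_eq_zero_of_isUnit hu, add_zero]

end Valuation

namespace XAc

variable (W : WeierstrassCurve K) (p : ℕ) [Fact p.Prime]
  (κ : ZpExtension K p) (𝔭 : HeightOneSpectrum (𝓞 K)) (S : Set (HeightOneSpectrum (𝓞 K)))
  (γ : absoluteGaloisGroup K) [Fact (κ.IsTopGenerator γ)]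

/-- **"`X_ac^Σ(E[p^∞])` is `Λ`-torsion and `ord_p f_ac^Σ(0) = n`"** ON THE REAL MODULE: `X_ac^Σ` is a
torsion `Λ`-module, its characteristic ideal is principal with a generator `f` whose constant term
`f(0) ∈ ℤ_p` is non-zero of `p`-adic valuation `n` (so `#ℤ_p/f(0) = p^n`). The left-hand side of
Cas18 Thm. 2.3's formula and of §5 (5.1); by `HasCharValuationAt.unique` the number `n` does not
depend on the generator. A predicate; nothing asserted.
[cite: Castella2018, Thm. 2.3 and §5 (5.1) (arXiv:1704.06608 pp. 5, 12) (shape only; nothing asserted)] -/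
def HasCharValuationAt (n : ℕ) : Prop :=
  Module.IsTorsion (IwasawaAlgebra p) (XAc W p κ 𝔭 S γ) ∧
    ∃ f : IwasawaAlgebra p, XAc.charIdeal W p κ 𝔭 S γ = Ideal.span {f} ∧
      PowerSeries.constantCoeff f ≠ 0 ∧ (PowerSeries.constantCoeff f).valuation = n

variable {W p κ 𝔭 S γ}

/-- `ord_p f_ac^Σ(0)` is well defined: two instances of `HasCharValuationAt` carry the same `n`.
[cite: Castella2018, Thm. 2.3 (arXiv:1704.06608 p. 5)] -/
theorem HasCharValuationAt.unique {m n : ℕ} (hm : HasCharValuationAt W p κ 𝔭 S γ m)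
    (hn : HasCharValuationAt W p κ 𝔭 S γ n) : m = n := by
  obtain ⟨_, f, hf, hf0, hfm⟩ := hm
  obtain ⟨_, g, hg, _, hgn⟩ := hn
  rw [← hfm, ← hgn]
  exact ((valuation_constantCoeff_eq_of_span_singleton_eq (hf.symm.trans hg) hf0).2).symm

end XAc

end Summit.BirchSwinnertonDyer.Rank1Residual.X11b.AcSelmer

end
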